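import Literature.Barriers.NavierStokesRegularity.InstantaneousTypeIBlowupLacunary
import HarnessLib

/-!
# Cheskidov–Dai–Palasek 2025, proof of Thm. 1.1: the lower bound `‖v(tₙ)‖_∞ ≳ tₙ^{-1/2}`
# along `tₙ = N_n^{-2}` from the block structure of the principal part

Fifth sibling proof file (all results proved; no definitions, no named facts) of the barrier
entry `Literature/Barriers/NavierStokesRegularity/InstantaneousTypeIBlowup` (A. Cheskidov, M. Dai,
S. Palasek, arXiv:2511.09556 (2025), Thm. 1.1). The proof of Thm. 1.1 (§6, p. 25) obtains the
lower Type-I bound from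

> "there exists a time sequence `tₙ → 0+` such that the principal velocity field `v` satisfies
> `v(tₙ) ∼ tₙ^{-1/2} e^{-1}`",

which print does not elaborate. The mechanism, proved here as `exists_lowerBound_seq_of_blocks`
(exactly the lower-bound clause of hypothesis `h₃` of `construction_of_blockBounds` /
`h₂` of `construction_of_decomposition`), is the block structure of §3.3 with Props. 4.2–4.3: the
approximate principal part is `v̄(t, x) = ∑ₖ N_k e^{-cN_k²t} b_k(x)` with bounded profiles
`‖b_k‖ ≤ B` (`b_k = -∑_j Δψ_{j,k}`, `‖Δψ_{j,k}‖_∞ ≲ 1`, Lemma 3.2) each of which is somewhere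
large, `‖b_k(x_k)‖ ≥ β > 0` (the normalisation `(2π)^{-d}∫φ²_{j,k} sin² = 1` of §3.2), over
scales with `N_{k+1}/N_k → ∞` (§3.1), and `‖v - v̄‖(t) ≤ e(t) t^{-1/2}` with `e(t) → 0`
(Prop. 4.2: `‖v_k - v̄_k‖_∞ ≤ ε₀ N_{1,k+1}^{-α}(t^{α-1/2} + 1)`, summed). At `tₙ = (cN_n²)^{-1}` the
`n`-th block contributes `e^{-1} N_n b_n`, the lower scales at most `2N_{n-1} B = o(N_n)`, the
higher scales at most `B N_n ∑_{m≥1} e^{-m ρ_n²/2} = o(N_n)` (`ρ_n = N_{n+1}/N_n`, using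
`r e^{-r²} ≤ e^{-r²/2}` and `4^m ≥ m + 1`), and the error `e(tₙ) √c N_n = o(N_n)`; hence
`‖v(tₙ, xₙ)‖ ≥ (β/2e) N_n = (β/(2e√c)) tₙ^{-1/2}` for `n ≥ n₀`.

## References

* A. Cheskidov, M. Dai, S. Palasek, arXiv:2511.09556 (2025): proof of Thm. 1.1 (§6, p. 25),
  §3.1, §3.3, Lemma 3.2, Props. 4.2–4.3. [`CheskidovDaiPalasek2025`]
-/

noncomputable section

open Set Filter Topology

namespace Literature.Barriers.NavierStokesRegularity

open Literature.Analysis.FluidPDE (pow_mul_le_of_lacunary le_of_lacunary cast_add_one_le_four_pow)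

/-! ## Elementary inequalities -/

section Elementary

/-- `r e^{-r²} ≤ e^{-r²/2}` for all real `r` (`r ≤ 1 + r²/2 ≤ e^{r²/2}`). [folklore] -/
theorem mul_exp_neg_sq_le_exp_neg_half (r : ℝ) :
    r * Real.exp (-r ^ 2) ≤ Real.exp (-(r ^ 2 / 2)) := by
  have h1 : r ≤ Real.exp (r ^ 2 / 2) := by
    have h2 : r ≤ 1 + r ^ 2 / 2 := by nlinarith [sq_nonneg (r - 1)]
    exact h2.trans (by linarith [Real.add_one_le_exp (r ^ 2 / 2)])
  have h3 : Real.exp (-r ^ 2) = Real.exp (-(r ^ 2 / 2)) * Real.exp (-(r ^ 2 / 2)) := by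
    rw [← Real.exp_add]; ring_nf
  rw [h3, ← mul_assoc]
  refine mul_le_of_le_one_left (Real.exp_pos _).le ?_
  calc r * Real.exp (-(r ^ 2 / 2)) ≤ Real.exp (r ^ 2 / 2) * Real.exp (-(r ^ 2 / 2)) :=
        mul_le_mul_of_nonneg_right h1 (Real.exp_pos _).le
    _ = 1 := by rw [← Real.exp_add, add_neg_cancel, Real.exp_zero]

/-- **One block above the window**: `M e^{-(M/L)²} ≤ L e^{-(M/L)²/2}` for `L > 0`. [folklore] -/
theorem mul_exp_neg_ratio_sq_le {M L : ℝ} (hL : 0 < L) :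
    M * Real.exp (-(M / L) ^ 2) ≤ L * Real.exp (-((M / L) ^ 2 / 2)) := by
  have h := mul_exp_neg_sq_le_exp_neg_half (M / L)
  have h1 : M * Real.exp (-(M / L) ^ 2) = L * (M / L * Real.exp (-(M / L) ^ 2)) := by
    field_simp
  rw [h1]
  exact mul_le_mul_of_nonneg_left h hL.le

end Elementary

/-! ## The approximate principal part at `tₙ = (cN_n²)^{-1}`: all blocks but the `n`-th are `o(N_n)` -/

section Blocks

variable {ι V : Type*} [NormedAddCommGroup V] [NormedSpace ℝ V] {N : ℕ → ℝ}

/-- **Lower scales**: `∑_{k<n} N_k e^{-cN_k²t} ‖b_k‖ ≤ 2 B N_{n-1}` (`n ≥ 1`), for `N_{k+1} ≥ 2N_k`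
and `‖b_k‖ ≤ B`. [cite: CheskidovDaiPalasek2025, proof of Thm. 1.1] -/
theorem sum_range_norm_smul_le (hN : ∀ k, 0 < N k) (hlac : ∀ k, 2 * N k ≤ N (k + 1))
    {c t B : ℝ} (hc : 0 ≤ c) (ht : 0 ≤ t) {b : ℕ → ι → V} (hB : ∀ k x, ‖b k x‖ ≤ B) (n : ℕ)
    (x : ι) :
    ∑ k ∈ Finset.range (n + 1), ‖(N k * Real.exp (-(c * N k ^ 2 * t))) • b k x‖ ≤
      2 * B * N n := by
  have hB0 : 0 ≤ B := (norm_nonneg _).trans (hB 0 x)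
  calc ∑ k ∈ Finset.range (n + 1), ‖(N k * Real.exp (-(c * N k ^ 2 * t))) • b k x‖
      ≤ ∑ k ∈ Finset.range (n + 1), N k * B := Finset.sum_le_sum fun k _ => by
        have hNk := hN k
        have h1 : Real.exp (-(c * N k ^ 2 * t)) ≤ 1 := by
          rw [Real.exp_le_one_iff, neg_nonpos]; positivity
        rw [norm_smul, Real.norm_eq_abs, abs_of_nonneg (by positivity)]
        calc N k * Real.exp (-(c * N k ^ 2 * t)) * ‖b k x‖ ≤ N k * 1 * B := by
              gcongr
              exact hB k x
          _ = N k * B := by ring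
    _ = (∑ k ∈ Finset.range (n + 1), N k) * B := by rw [Finset.sum_mul]
    _ ≤ 2 * N n * B :=
        mul_le_mul_of_nonneg_right (sum_range_succ_le_two_mul_of_lacunary (fun k => (hN k).le) hlac n) hB0
    _ = 2 * B * N n := by ring

/-- **Higher scales**: at `t = (cN_n²)^{-1}`, for `m ≥ 0`,
`N_{n+1+m} e^{-cN_{n+1+m}² t} ≤ N_n q_n^{m+1}`, `q_n = exp(-(N_{n+1}/N_n)²/2)` (the ratio
`N_{n+1+m}/N_n ≥ 2^m N_{n+1}/N_n`, `4^m ≥ m+1`, and `r e^{-r²} ≤ e^{-r²/2}`).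
[cite: CheskidovDaiPalasek2025, proof of Thm. 1.1] -/
theorem scale_mul_exp_neg_le_pow (hN : ∀ k, 0 < N k) (hlac : ∀ k, 2 * N k ≤ N (k + 1))
    {c : ℝ} (hc : 0 < c) (n m : ℕ) :
    N (n + 1 + m) * Real.exp (-(c * N (n + 1 + m) ^ 2 * (1 / (c * N n ^ 2)))) ≤
      N n * Real.exp (-((N (n + 1) / N n) ^ 2 / 2)) ^ (m + 1) := by
  have hNn := hN n
  have hNn1 := hN (n + 1)
  set ρ : ℝ := N (n + 1) / N n with hρ
  have hρ0 : 0 < ρ := div_pos hNn1 hNn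
  -- the ratio `r = N_{n+1+m}/N_n ≥ 2^m ρ`
  set r : ℝ := N (n + 1 + m) / N n with hr
  have hgrow : 2 ^ m * N (n + 1) ≤ N (n + 1 + m) :=
    pow_mul_le_of_lacunary (by norm_num : (0 : ℝ) ≤ 2) hlac (n + 1) m
  have hr1 : 2 ^ m * ρ ≤ r := by
    rw [hρ, hr, ← mul_div_assoc]
    exact div_le_div_of_nonneg_right hgrow hNn.le
  have hr0 : 0 ≤ 2 ^ m * ρ := by positivity
  -- `r² ≥ 4^m ρ² ≥ (m+1) ρ²`
  have hr2 : ((m : ℝ) + 1) * ρ ^ 2 ≤ r ^ 2 := by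
    have h1 : (2 ^ m * ρ) ^ 2 ≤ r ^ 2 := pow_le_pow_left₀ hr0 hr1 2
    have h2 : ((2 : ℝ) ^ m) ^ 2 = 4 ^ m := by
      rw [← pow_mul, mul_comm, pow_mul]; norm_num
    have h3 : ((m : ℝ) + 1) * ρ ^ 2 ≤ 4 ^ m * ρ ^ 2 :=
      mul_le_mul_of_nonneg_right (cast_add_one_le_four_pow m) (sq_nonneg ρ)
    calc ((m : ℝ) + 1) * ρ ^ 2 ≤ 4 ^ m * ρ ^ 2 := h3
      _ = (2 ^ m * ρ) ^ 2 := by rw [mul_pow, h2]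
      _ ≤ r ^ 2 := h1
  -- rewrite the exponent as `-(r²)`
  have hexp : c * N (n + 1 + m) ^ 2 * (1 / (c * N n ^ 2)) = r ^ 2 := by
    rw [hr]
    field_simp
  rw [hexp]
  have hM : N (n + 1 + m) = r * N n := by rw [hr]; field_simp
  calc N (n + 1 + m) * Real.exp (-r ^ 2) = N n * (r * Real.exp (-r ^ 2)) := by rw [hM]; ring
    _ ≤ N n * Real.exp (-(r ^ 2 / 2)) :=
        mul_le_mul_of_nonneg_left (mul_exp_neg_sq_le_exp_neg_half r) hNn.le
    _ ≤ N n * Real.exp (-(((m : ℝ) + 1) * ρ ^ 2 / 2)) := by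
        gcongr
    _ = N n * Real.exp (-(ρ ^ 2 / 2)) ^ (m + 1) := by
        rw [← Real.exp_nat_mul]
        congr 1
        push_cast
        ring

/-- **All blocks but the `n`-th at `tₙ = (cN_n²)^{-1}`**: if
`v̄(tₙ, x) = ∑ₖ N_k e^{-cN_k²tₙ} b_k(x)` with `‖b_k‖ ≤ B`, `N_{k+1} ≥ 2N_k`, and
`q_n = exp(-(N_{n+1}/N_n)²/2) ≤ 1/2`, then
`‖v̄(tₙ, x) - e^{-1}N_n b_n(x)‖ ≤ B (2N_{n-1} + 2N_n q_n)` (`n ≥ 1`).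
[cite: CheskidovDaiPalasek2025, proof of Thm. 1.1] -/
theorem norm_sub_main_block_le (hN : ∀ k, 0 < N k) (hlac : ∀ k, 2 * N k ≤ N (k + 1))
    {c : ℝ} (hc : 0 < c) {B : ℝ} {b : ℕ → ι → V} (hB : ∀ k x, ‖b k x‖ ≤ B) (n : ℕ) (x : ι)
    {S : V} (hS : HasSum (fun k => (N k * Real.exp (-(c * N k ^ 2 * (1 / (c * N (n + 1) ^ 2))))) • b k x) S)
    (hq : Real.exp (-((N (n + 2) / N (n + 1)) ^ 2 / 2)) ≤ 1 / 2) :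
    ‖S - (N (n + 1) * Real.exp (-1)) • b (n + 1) x‖ ≤
      B * (2 * N n + 2 * N (n + 1) * Real.exp (-((N (n + 2) / N (n + 1)) ^ 2 / 2))) := by
  have hB0 : 0 ≤ B := (norm_nonneg _).trans (hB 0 x)
  set t : ℝ := 1 / (c * N (n + 1) ^ 2) with ht
  set f : ℕ → V := fun k => (N k * Real.exp (-(c * N k ^ 2 * t))) • b k x with hf
  set q : ℝ := Real.exp (-((N (n + 2) / N (n + 1)) ^ 2 / 2)) with hq_def
  have hq0 : 0 < q := Real.exp_pos _
  have hNn1 := hN (n + 1)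
  have ht0 : 0 < t := by positivity
  -- the `n+1`-st term
  have hmain : f (n + 1) = (N (n + 1) * Real.exp (-1)) • b (n + 1) x := by
    simp only [hf, ht]
    congr 2
    field_simp
  -- splitting the series
  have hsum : Summable f := hS.summable
  have hsplit : S = (∑ k ∈ Finset.range (n + 1), f k) + f (n + 1) + ∑' k, f (k + (n + 2)) := by
    rw [← hS.tsum_eq, ← hsum.sum_add_tsum_nat_add (n + 2), Finset.sum_range_succ]
  -- the tail is dominated by a geometric series
  have htail_le : ∀ k, ‖f (k + (n + 2))‖ ≤ B * N (n + 1) * q ^ (k + 1) := by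
    intro k
    have h1 := scale_mul_exp_neg_le_pow hN hlac hc (n + 1) k
    have h2 : n + 1 + 1 + k = k + (n + 2) := by ring
    rw [h2] at h1
    have hNk := hN (k + (n + 2))
    simp only [hf]
    rw [norm_smul, Real.norm_eq_abs, abs_of_nonneg (by positivity)]
    calc N (k + (n + 2)) * Real.exp (-(c * N (k + (n + 2)) ^ 2 * t)) * ‖b (k + (n + 2)) x‖
        ≤ N (n + 1) * q ^ (k + 1) * B := mul_le_mul h1 (hB _ x) (norm_nonneg _) (by positivity)
      _ = B * N (n + 1) * q ^ (k + 1) := by ring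
  have hgeom : Summable fun k : ℕ => B * N (n + 1) * q ^ (k + 1) := by
    have hq1 : q < 1 := by linarith
    simp_rw [pow_succ]
    exact ((summable_geometric_of_lt_one hq0.le hq1).mul_right q).mul_left _
  have htail_sum : Summable fun k => ‖f (k + (n + 2))‖ :=
    Summable.of_nonneg_of_le (fun k => norm_nonneg _) htail_le hgeom
  have htail : ‖∑' k, f (k + (n + 2))‖ ≤ 2 * B * N (n + 1) * q := by
    calc ‖∑' k, f (k + (n + 2))‖ ≤ ∑' k, ‖f (k + (n + 2))‖ := norm_tsum_le_tsum_norm htail_sum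
      _ ≤ ∑' k : ℕ, B * N (n + 1) * q ^ (k + 1) := htail_sum.tsum_le_tsum htail_le hgeom
      _ = B * N (n + 1) * (q / (1 - q)) := by
          simp_rw [pow_succ]
          rw [tsum_mul_left, tsum_mul_right, tsum_geometric_of_lt_one hq0.le (by linarith)]
          field_simp
      _ ≤ B * N (n + 1) * (2 * q) := by
          refine mul_le_mul_of_nonneg_left ?_ (by positivity)
          rw [div_le_iff₀ (by linarith)]
          nlinarith
      _ = 2 * B * N (n + 1) * q := by ring
  -- the head
  have hhead : ‖∑ k ∈ Finset.range (n + 1), f k‖ ≤ 2 * B * N n :=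
    (norm_sum_le _ _).trans (sum_range_norm_smul_le hN hlac hc.le ht0.le hB n x)
  calc ‖S - (N (n + 1) * Real.exp (-1)) • b (n + 1) x‖
      = ‖(∑ k ∈ Finset.range (n + 1), f k) + ∑' k, f (k + (n + 2))‖ := by
        rw [hsplit, hmain]
        congr 1
        abel
    _ ≤ ‖∑ k ∈ Finset.range (n + 1), f k‖ + ‖∑' k, f (k + (n + 2))‖ := norm_add_le _ _
    _ ≤ 2 * B * N n + 2 * B * N (n + 1) * q := add_le_add hhead htail
    _ = B * (2 * N n + 2 * N (n + 1) * q) := by ring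

end Blocks

/-! ## The lower bound along `tₙ = (cN_n²)^{-1}` -/

section LowerBound

variable {ι V : Type*} [NormedAddCommGroup V] [NormedSpace ℝ V] {N : ℕ → ℝ}

/-- **The lower Type-I bound of the principal part from its block structure**
(the clause "`∃ c₀ > 0, ∃ tₖ → 0⁺ in (0, τ], ‖v(tₖ, xₖ)‖ ≥ c₀ tₖ^{-1/2}`" of hypothesis `h₃` of
`construction_of_blockBounds`). Let `N_k > 0` with `N_{k+1} ≥ 2N_k` and `N_{k+1}/N_k → ∞`
(§3.1), `c > 0`; let the approximate principal part be `v̄(t, x) = ∑ₖ N_k e^{-cN_k²t} b_k(x)` for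
`t > 0` with profiles `‖b_k(x)‖ ≤ B` each attaining `‖b_k(x_k)‖ ≥ β > 0` somewhere (§3.3,
Lemma 3.2 and the normalisation of §3.2); and let `‖v(t,x) - v̄(t,x)‖ ≤ e(t)/√t` on `(0, τ]` with
`e(t) → 0` as `t → 0⁺` (Prop. 4.2 summed over `k`). Then there are `c₀ > 0` and times
`sₖ ∈ (0, τ]`, `sₖ → 0`, with `sup_x ‖v(sₖ, x)‖ ≥ c₀ sₖ^{-1/2}`: namely `sₖ = (cN²_{k+n₀})^{-1}` and
`c₀ = β/(2e√c)` ("`v(tₙ) ∼ tₙ^{-1/2} e^{-1}`").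
[cite: CheskidovDaiPalasek2025, proof of Thm. 1.1 (§6, p. 25)] -/
theorem exists_lowerBound_seq_of_blocks (hN : ∀ k, 0 < N k) (hlac : ∀ k, 2 * N k ≤ N (k + 1))
    (hsuper : Tendsto (fun k => N (k + 1) / N k) atTop atTop) {c : ℝ} (hc : 0 < c)
    {B β : ℝ} (hβ : 0 < β) {b : ℕ → ι → V} (hB : ∀ k x, ‖b k x‖ ≤ B)
    (hbβ : ∀ k, ∃ x, β ≤ ‖b k x‖) {τ : ℝ} (hτ : 0 < τ) {vbar v : ℝ → ι → V}
    (hvbar : ∀ t, 0 < t → ∀ x,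
      HasSum (fun k => (N k * Real.exp (-(c * N k ^ 2 * t))) • b k x) (vbar t x))
    {e : ℝ → ℝ} (he : Tendsto e (𝓝[>] 0) (𝓝 0))
    (herr : ∀ t ∈ Ioc 0 τ, ∀ x, ‖v t x - vbar t x‖ ≤ e t / Real.sqrt t) :
    ∃ c₀ : ℝ, 0 < c₀ ∧ ∃ s : ℕ → ℝ, (∀ k, 0 < s k ∧ s k ≤ τ) ∧ Tendsto s atTop (𝓝 0) ∧
      ∀ k, ∃ x, c₀ / Real.sqrt (s k) ≤ ‖v (s k) x‖ := by
  obtain ⟨x₀, hx₀⟩ := hbβ 0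
  have hBβ : β ≤ B := hx₀.trans (hB 0 x₀)
  have hB0 : 0 < B := hβ.trans_le hBβ
  -- the times `t n = (c N_{n+1}²)^{-1}` (indexing from `n + 1` so that `n ≥ 1` is automatic)
  set t : ℕ → ℝ := fun n => 1 / (c * N (n + 1) ^ 2) with ht_def
  have ht0 : ∀ n, 0 < t n := fun n => by have := hN (n + 1); positivity
  have hsqrt : ∀ n, Real.sqrt (t n) = 1 / (Real.sqrt c * N (n + 1)) := by
    intro n
    have := hN (n + 1)
    rw [ht_def]
    dsimp only
    rw [Real.sqrt_div' _ (by positivity), Real.sqrt_one, Real.sqrt_mul hc.le, Real.sqrt_sq this.le]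
  -- `t n → 0⁺`
  have hN_top : Tendsto (fun n => N (n + 1)) atTop atTop := by
    have h2 : Tendsto (fun n : ℕ => (2 : ℝ) ^ (n + 1) * N 0) atTop atTop :=
      ((tendsto_pow_atTop_atTop_of_one_lt one_lt_two).comp (tendsto_add_atTop_nat 1)).atTop_mul_const
        (hN 0)
    refine tendsto_atTop_mono (fun n => ?_) h2
    have h := pow_mul_le_of_lacunary (by norm_num : (0 : ℝ) ≤ 2) hlac 0 (n + 1)
    rw [zero_add] at h
    exact h
  have ht_zero : Tendsto t atTop (𝓝 0) := by
    have h1 : Tendsto (fun n => c * N (n + 1) ^ 2) atTop atTop :=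
      Tendsto.const_mul_atTop hc ((tendsto_pow_atTop two_ne_zero).comp hN_top)
    have h2 := h1.inv_tendsto_atTop
    refine h2.congr fun n => ?_
    simp [ht_def, one_div]
  have ht_within : Tendsto t atTop (𝓝[>] 0) :=
    tendsto_nhdsWithin_iff.2 ⟨ht_zero, Eventually.of_forall fun n => ht0 n⟩
  have he_t : Tendsto (fun n => e (t n)) atTop (𝓝 0) := he.comp ht_within
  -- the ratios `ρ n = N_{n+1}/N_n → ∞` and the tail factors `q n = exp(-(ρ (n+1))²/2) → 0`
  set ρ : ℕ → ℝ := fun n => N (n + 1) / N n with hρ_def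
  have hρ0 : ∀ n, 0 < ρ n := fun n => div_pos (hN (n + 1)) (hN n)
  set q : ℕ → ℝ := fun n => Real.exp (-((ρ (n + 1)) ^ 2 / 2)) with hq_def
  have hq0 : ∀ n, 0 < q n := fun n => Real.exp_pos _
  have hρ_inv : Tendsto (fun n => 2 * B * (ρ n)⁻¹) atTop (𝓝 0) := by
    have h := hsuper.inv_tendsto_atTop
    simpa using h.const_mul (2 * B)
  have hq_zero : Tendsto (fun n => 2 * B * q n) atTop (𝓝 0) := by
    have h1 : Tendsto (fun n => (ρ (n + 1)) ^ 2 / 2) atTop atTop :=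
      ((tendsto_pow_atTop two_ne_zero).comp (hsuper.comp (tendsto_add_atTop_nat 1))).atTop_div_const
        (by norm_num)
    have h2 : Tendsto q atTop (𝓝 0) := Real.tendsto_exp_neg_atTop_nhds_zero.comp h1
    simpa using h2.const_mul (2 * B)
  -- thresholds
  set θ : ℝ := Real.exp (-1) * β / 8 with hθ
  have hθ0 : 0 < θ := by positivity
  have hsc : 0 < Real.sqrt c := Real.sqrt_pos.2 hc
  have h1 : ∀ᶠ n in atTop, 2 * B * (ρ n)⁻¹ < θ := Filter.Tendsto.eventually_lt_const hθ0 hρ_inv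
  have h2 : ∀ᶠ n in atTop, 2 * B * q n < θ := Filter.Tendsto.eventually_lt_const hθ0 hq_zero
  have h3 : ∀ᶠ n in atTop, 2 * B * q n < B := Filter.Tendsto.eventually_lt_const hB0 hq_zero
  have h4 : ∀ᶠ n in atTop, e (t n) < 2 * θ / Real.sqrt c :=
    Filter.Tendsto.eventually_lt_const (by positivity) he_t
  have h5 : ∀ᶠ n in atTop, t n < τ := Filter.Tendsto.eventually_lt_const hτ ht_zero
  obtain ⟨n₀, hn₀⟩ := eventually_atTop.1 (h1.and (h2.and (h3.and (h4.and h5))))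
  -- the lower bound at `t n`, `n ≥ n₀`
  have hkey : ∀ n, n₀ ≤ n → ∃ x, Real.exp (-1) * β / 2 * N (n + 1) ≤ ‖v (t n) x‖ := by
    intro n hn
    obtain ⟨hn1, hn2, hn3, hn4, hn5⟩ := hn₀ n hn
    obtain ⟨x, hx⟩ := hbβ (n + 1)
    refine ⟨x, ?_⟩
    have hNn := hN n
    have hNn1 := hN (n + 1)
    have htn : t n ∈ Ioc 0 τ := ⟨ht0 n, hn5.le⟩
    -- `q n ≤ 1/2`
    have hqn : q n ≤ 1 / 2 := by
      have : 2 * B * q n < B := hn3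
      nlinarith
    -- the other blocks
    have hS := hvbar (t n) (ht0 n) x
    have hother : ‖vbar (t n) x - (N (n + 1) * Real.exp (-1)) • b (n + 1) x‖ ≤
        B * (2 * N n + 2 * N (n + 1) * q n) :=
      norm_sub_main_block_le hN hlac hc hB n x hS hqn
    have hother' : B * (2 * N n + 2 * N (n + 1) * q n) ≤ N (n + 1) * (2 * θ) := by
      have e1 : B * (2 * N n + 2 * N (n + 1) * q n) =
          N (n + 1) * (2 * B * (ρ n)⁻¹ + 2 * B * q n) := by
        simp only [hρ_def]
        field_simp
      rw [e1]
      exact mul_le_mul_of_nonneg_left (by linarith) hNn1.le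
    -- the error `v - v̄`
    have herr' : ‖v (t n) x - vbar (t n) x‖ ≤ N (n + 1) * (2 * θ) := by
      calc ‖v (t n) x - vbar (t n) x‖ ≤ e (t n) / Real.sqrt (t n) := herr (t n) htn x
        _ = e (t n) * (Real.sqrt c * N (n + 1)) := by rw [hsqrt n]; field_simp
        _ ≤ 2 * θ / Real.sqrt c * (Real.sqrt c * N (n + 1)) :=
            mul_le_mul_of_nonneg_right hn4.le (by positivity)
        _ = N (n + 1) * (2 * θ) := by field_simp
    -- the main block
    have hmain : Real.exp (-1) * β * N (n + 1) ≤ ‖(N (n + 1) * Real.exp (-1)) • b (n + 1) x‖ := by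
      rw [norm_smul, Real.norm_eq_abs, abs_of_nonneg (by positivity)]
      calc Real.exp (-1) * β * N (n + 1) = N (n + 1) * Real.exp (-1) * β := by ring
        _ ≤ N (n + 1) * Real.exp (-1) * ‖b (n + 1) x‖ :=
            mul_le_mul_of_nonneg_left hx (by positivity)
    -- triangle inequality
    have htri : ‖(N (n + 1) * Real.exp (-1)) • b (n + 1) x‖ ≤
        ‖v (t n) x‖ + ‖v (t n) x - vbar (t n) x‖ +
          ‖vbar (t n) x - (N (n + 1) * Real.exp (-1)) • b (n + 1) x‖ := by
      have e1 : (N (n + 1) * Real.exp (-1)) • b (n + 1) x =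
          v (t n) x - (v (t n) x - vbar (t n) x) -
            (vbar (t n) x - (N (n + 1) * Real.exp (-1)) • b (n + 1) x) := by abel
      calc ‖(N (n + 1) * Real.exp (-1)) • b (n + 1) x‖
          = ‖v (t n) x - (v (t n) x - vbar (t n) x) -
              (vbar (t n) x - (N (n + 1) * Real.exp (-1)) • b (n + 1) x)‖ := by rw [← e1]
        _ ≤ ‖v (t n) x - (v (t n) x - vbar (t n) x)‖ +
              ‖vbar (t n) x - (N (n + 1) * Real.exp (-1)) • b (n + 1) x‖ := norm_sub_le _ _
        _ ≤ ‖v (t n) x‖ + ‖v (t n) x - vbar (t n) x‖ +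
              ‖vbar (t n) x - (N (n + 1) * Real.exp (-1)) • b (n + 1) x‖ := by
            gcongr
            exact norm_sub_le _ _
    have hθ8 : 8 * θ = Real.exp (-1) * β := by rw [hθ]; ring
    nlinarith [hmain, htri, hother, hother', herr', hNn1]
  -- the sequence
  refine ⟨Real.exp (-1) * β / (2 * Real.sqrt c), by positivity, fun k => t (k + n₀),
    fun k => ⟨ht0 _, ?_⟩, ht_zero.comp (tendsto_add_atTop_nat n₀), fun k => ?_⟩
  · exact ((hn₀ (k + n₀) (Nat.le_add_left _ _)).2.2.2.2).le
  · obtain ⟨x, hx⟩ := hkey (k + n₀) (Nat.le_add_left _ _)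
    refine ⟨x, le_trans (le_of_eq ?_) hx⟩
    rw [hsqrt]
    have := hN (k + n₀ + 1)
    field_simp

end LowerBound

end Literature.Barriers.NavierStokesRegularity
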